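import Mathlib
import HarnessLib

/-!
# `ContinuumLegGivenGap` (stmt-QuantumFields-15828), line `alternating-curvature-arrays`: `stub_productToUniform`, helper P4b — Mathlib's `expNegInvGlue` is Gevrey-2 with explicit constants

Support file for the Whitney / grid-shift / nuclear step `stub_productToUniform` ((PB) ⇒ (UUVB)).  After the localised
bound (helper P4a, `localBound_of_productBound`: `‖T_z G‖ ≤ D^p K^p |G|_{p t}`) the remaining Whitney bookkeeping feeds
`G = F · Ψ` with `Ψ` a smooth partition-of-unity weight on `(ℝ⁴)^p`; its Schwartz norm of order `p t` differentiates the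
one-dimensional profile of `Ψ` up to `p t` times, so the shape `α^p (p!)^β` of (UUVB) needs a profile whose derivatives
grow at most factorially, with EXPLICIT constants.  This file supplies it for Mathlib's glue function
`expNegInvGlue x = exp(-1/x)` (`x > 0`), `= 0` (`x ≤ 0`):

* `gevrey_norm_cexp_neg_inv_le` — on the circle `|z - x| = x/2` (`x > 0`), `‖exp(-1/z)‖ ≤ exp(-2/(9x))`;
* `gevrey_iteratedDeriv_ofReal` — the real iterated derivatives of `expNegInvGlue` on `x > 0` are the complex ones of
  `z ↦ exp(-1/z)` (induction, `HasDerivAt.comp_ofReal` / `HasDerivAt.ofReal_comp`);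
* `gevrey_abs_iteratedDeriv_expNegInvGlue_le` (registered anchor) — Cauchy's estimate
  (`Complex.norm_iteratedDeriv_le_of_forall_mem_sphere_norm_le`) and `(9u)ⁿ e^{-u} ≤ 9ⁿ n!` give
  `|expNegInvGlue⁽ⁿ⁾(x)| ≤ 9ⁿ (n!)²` for ALL `n` and `x` (Gevrey class 2);
* `gevrey_abs_iteratedDeriv_expNegInvGlue_le_geom` — the geometric form `≤ (9 N²)ⁱ` for `i ≤ N` consumed by Mathlib's
  `norm_iteratedFDeriv_comp_le` / `norm_iteratedFDeriv_mul_le` (`i! ≤ Nⁱ`).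

Pure one-variable calculus; Mathlib only; no definitions. [folklore]
-/

set_option autoImplicit false

noncomputable section

namespace Summit.QuantumFields.YangMills.Theorems.ContinuumLegGivenGap

open Complex Set Filter Topology Metric

/-! ## §1 The complex extension `z ↦ exp(-1/z)` -/

/-- `z ↦ exp(-1/z)` is analytic away from the origin. [folklore] -/
theorem gevrey_analyticAt_cexp_neg_inv {z : ℂ} (hz : z ≠ 0) : AnalyticAt ℂ (fun w : ℂ => exp (-w⁻¹)) z :=
  ((analyticAt_id.inv hz).neg).cexp'

/-- `z ↦ exp(-1/z)` is complex differentiable away from the origin. [folklore] -/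
theorem gevrey_differentiableOn_cexp_neg_inv : DifferentiableOn ℂ (fun w : ℂ => exp (-w⁻¹)) {w | w ≠ 0} :=
  fun _ hz => (gevrey_analyticAt_cexp_neg_inv hz).differentiableAt.differentiableWithinAt

/-- The closed disc of radius `x/2` about the real point `x > 0` avoids the origin. [folklore] -/
theorem gevrey_closedBall_subset {x : ℝ} (hx : 0 < x) : closedBall (x : ℂ) (x / 2) ⊆ {w : ℂ | w ≠ 0} := by
  intro w hw h0
  rw [mem_closedBall, h0, dist_comm, dist_zero_right, norm_real, Real.norm_of_nonneg hx.le] at hw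
  linarith

/-- **The boundary bound**: on the circle `|z - x| = x/2` (`x > 0`), `Re(1/z) ≥ 2/(9x)`, hence
`‖exp(-1/z)‖ ≤ exp(-2/(9x))`. [folklore] -/
theorem gevrey_norm_cexp_neg_inv_le {x : ℝ} (hx : 0 < x) {z : ℂ} (hz : z ∈ sphere (x : ℂ) (x / 2)) :
    ‖exp (-z⁻¹)‖ ≤ Real.exp (-(2 / (9 * x))) := by
  rw [mem_sphere, dist_eq_norm] at hz
  rw [norm_exp, Real.exp_le_exp, neg_re, inv_re, neg_le_neg_iff]
  -- `z.re ≥ x/2` and `normSq z ≤ (3x/2)²`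
  have hre : x / 2 ≤ z.re := by
    have h1 : |(z - x).re| ≤ ‖z - (x : ℂ)‖ := abs_re_le_norm _
    rw [hz, sub_re, ofReal_re] at h1
    have h2 := abs_le.1 h1
    linarith
  have hnorm : ‖z‖ ≤ 3 * x / 2 := by
    calc ‖z‖ = ‖(z - x) + (x : ℂ)‖ := by rw [sub_add_cancel]
      _ ≤ ‖z - (x : ℂ)‖ + ‖(x : ℂ)‖ := norm_add_le _ _
      _ = 3 * x / 2 := by rw [hz, norm_real, Real.norm_of_nonneg hx.le]; ring
  have hz0 : z ≠ 0 := gevrey_closedBall_subset hx (mem_closedBall.2 (by rw [dist_eq_norm, hz]))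
  have hns : 0 < normSq z := normSq_pos.2 hz0
  have hns' : normSq z ≤ (3 * x / 2) ^ 2 := by
    rw [normSq_eq_norm_sq]
    exact pow_le_pow_left₀ (norm_nonneg _) hnorm 2
  rw [div_le_div_iff₀ (by positivity) hns]
  nlinarith

/-- **Cauchy's estimate** for `z ↦ exp(-1/z)` at a real point `x > 0` on the disc of radius `x/2`:
`‖(exp(-1/z))⁽ⁿ⁾(x)‖ ≤ n! exp(-2/(9x)) / (x/2)ⁿ`. [folklore] -/
theorem gevrey_norm_iteratedDeriv_cexp_le {x : ℝ} (hx : 0 < x) (n : ℕ) :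
    ‖iteratedDeriv n (fun w : ℂ => exp (-w⁻¹)) (x : ℂ)‖ ≤ n.factorial * Real.exp (-(2 / (9 * x))) / (x / 2) ^ n :=
  norm_iteratedDeriv_le_of_forall_mem_sphere_norm_le n (half_pos hx)
    (gevrey_differentiableOn_cexp_neg_inv.diffContOnCl_ball (gevrey_closedBall_subset hx))
    fun _ hz => gevrey_norm_cexp_neg_inv_le hx hz

/-! ## §2 Real versus complex iterated derivatives -/

/-- On `x > 0` the glue function is `exp(-1/x)`. [folklore] -/
theorem gevrey_expNegInvGlue_of_pos {x : ℝ} (hx : 0 < x) : expNegInvGlue x = Real.exp (-x⁻¹) := by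
  simp [expNegInvGlue, not_le.2 hx]

/-- **Real iterated derivatives of `expNegInvGlue` are the complex ones of `exp(-1/z)`** at every `x > 0`. [folklore] -/
theorem gevrey_iteratedDeriv_ofReal (n : ℕ) {x : ℝ} (hx : 0 < x) :
    iteratedDeriv n (fun w : ℂ => exp (-w⁻¹)) (x : ℂ) = ((iteratedDeriv n expNegInvGlue x : ℝ) : ℂ) := by
  induction n generalizing x with
  | zero =>
    simp only [iteratedDeriv_zero]
    rw [gevrey_expNegInvGlue_of_pos hx, ofReal_exp, ofReal_neg, ofReal_inv]
  | succ n ih =>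
    -- the complex `n`-th derivative is analytic at `x`, with derivative the `(n+1)`-st
    set Dn : ℂ → ℂ := deriv^[n] (fun w : ℂ => exp (-w⁻¹)) with hDn
    have hx0 : (x : ℂ) ≠ 0 := ofReal_ne_zero.2 hx.ne'
    have hDa : AnalyticAt ℂ Dn (x : ℂ) := (gevrey_analyticAt_cexp_neg_inv hx0).iterated_deriv n
    have hc : HasDerivAt (fun t : ℝ => Dn (t : ℂ)) (deriv Dn (x : ℂ)) x :=
      (hDa.differentiableAt.hasDerivAt).comp_ofReal
    -- near `x` it agrees with the complexified real `n`-th derivative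
    have hev : (fun t : ℝ => Dn (t : ℂ)) =ᶠ[𝓝 x] fun t : ℝ => ((iteratedDeriv n expNegInvGlue t : ℝ) : ℂ) := by
      filter_upwards [Ioi_mem_nhds hx] with t ht
      rw [hDn, ← iteratedDeriv_eq_iterate]
      exact ih ht
    have hc' : HasDerivAt (fun t : ℝ => ((iteratedDeriv n expNegInvGlue t : ℝ) : ℂ)) (deriv Dn (x : ℂ)) x :=
      hc.congr_of_eventuallyEq hev.symm
    -- the real `n`-th derivative is differentiable, with derivative the `(n+1)`-st
    have hr : HasDerivAt (iteratedDeriv n expNegInvGlue) (deriv (iteratedDeriv n expNegInvGlue) x) x :=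
      ((expNegInvGlue.contDiff (n := ⊤)).differentiable_iteratedDeriv n
        (mod_cast ENat.coe_lt_top n)).differentiableAt.hasDerivAt
    have huniq : deriv Dn (x : ℂ) = ((deriv (iteratedDeriv n expNegInvGlue) x : ℝ) : ℂ) := hc'.unique hr.ofReal_comp
    rw [iteratedDeriv_succ, iteratedDeriv_eq_iterate, ← hDn]
    rw [huniq, ← iteratedDeriv_succ]

/-! ## §3 The Gevrey-2 bound -/

/-- The elementary maximisation `(9u)ⁿ e^{-u} ≤ 9ⁿ n!` (`u ≥ 0`; from `uⁿ/n! ≤ eᵘ`). [folklore] -/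
theorem gevrey_nine_mul_pow_mul_exp_neg_le {u : ℝ} (hu : 0 ≤ u) (n : ℕ) :
    (9 * u) ^ n * Real.exp (-u) ≤ 9 ^ n * n.factorial := by
  have h := Real.pow_div_factorial_le_exp u hu n
  have hf : (0 : ℝ) < n.factorial := by exact_mod_cast Nat.factorial_pos n
  rw [div_le_iff₀ hf] at h
  have h1 : u ^ n * Real.exp (-u) ≤ n.factorial := by
    rw [Real.exp_neg, ← div_eq_mul_inv, div_le_iff₀ (Real.exp_pos u)]
    linarith
  calc (9 * u) ^ n * Real.exp (-u) = 9 ^ n * (u ^ n * Real.exp (-u)) := by rw [mul_pow]; ring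
    _ ≤ 9 ^ n * n.factorial := mul_le_mul_of_nonneg_left h1 (by positivity)

/-- The bound on `x > 0`: `|expNegInvGlue⁽ⁿ⁾(x)| ≤ 9ⁿ (n!)²`. [folklore] -/
theorem gevrey_abs_iteratedDeriv_le_of_pos (n : ℕ) {x : ℝ} (hx : 0 < x) :
    |iteratedDeriv n expNegInvGlue x| ≤ 9 ^ n * (n.factorial : ℝ) ^ 2 := by
  have h := gevrey_norm_iteratedDeriv_cexp_le hx n
  rw [gevrey_iteratedDeriv_ofReal n hx, norm_real, Real.norm_eq_abs] at h
  refine h.trans ?_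
  -- `n! e^{-2/(9x)} (2/x)ⁿ ≤ n! · 9ⁿ n!` with `u = 2/(9x)`
  set u : ℝ := 2 / (9 * x) with hu
  have hu0 : 0 ≤ u := by positivity
  have hx2 : x / 2 = (9 * u)⁻¹ := by rw [hu, mul_div_assoc', inv_div]; ring
  have hkey := gevrey_nine_mul_pow_mul_exp_neg_le hu0 n
  have hf : (0 : ℝ) ≤ n.factorial := Nat.cast_nonneg _
  rw [hx2, inv_pow, div_inv_eq_mul]
  calc (n.factorial : ℝ) * Real.exp (-u) * (9 * u) ^ n
      = n.factorial * ((9 * u) ^ n * Real.exp (-u)) := by ring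
    _ ≤ n.factorial * (9 ^ n * n.factorial) := mul_le_mul_of_nonneg_left hkey hf
    _ = 9 ^ n * (n.factorial : ℝ) ^ 2 := by ring

/-- The iterated derivatives vanish on `x ≤ 0`: the glue function is locally zero on `x < 0`, and at the origin by
continuity from the left. [folklore] -/
theorem gevrey_iteratedDeriv_eq_zero_of_nonpos (n : ℕ) {x : ℝ} (hx : x ≤ 0) : iteratedDeriv n expNegInvGlue x = 0 := by
  -- on `x < 0`
  have hneg : ∀ y : ℝ, y < 0 → iteratedDeriv n expNegInvGlue y = 0 := fun y hy => by
    have hev : expNegInvGlue =ᶠ[𝓝 y] fun _ => (0 : ℝ) := by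
      filter_upwards [Iio_mem_nhds hy] with t ht
      exact expNegInvGlue.zero_of_nonpos ht.le
    rw [hev.iteratedDeriv_eq n, iteratedDeriv_const]
    split_ifs <;> rfl
  rcases hx.lt_or_eq with hlt | rfl
  · exact hneg x hlt
  · -- at the origin: the zero set is closed and contains `(-∞, 0)`
    have hcont : Continuous (iteratedDeriv n expNegInvGlue) :=
      (expNegInvGlue.contDiff (n := ⊤)).continuous_iteratedDeriv n (mod_cast le_top)
    have hcl : IsClosed {y : ℝ | iteratedDeriv n expNegInvGlue y = 0} := isClosed_eq hcont continuous_const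
    have h0 : (0 : ℝ) ∈ closure (Iio (0 : ℝ)) := by rw [closure_Iio]; exact self_mem_Iic
    exact hcl.closure_subset_iff.2 (fun y hy => hneg y hy) h0

/-- **`expNegInvGlue` is Gevrey-2 with explicit constants** (registered anchor): for all `n` and all real `x`,
`|expNegInvGlue⁽ⁿ⁾(x)| ≤ 9ⁿ (n!)²`. [folklore] -/
theorem gevrey_abs_iteratedDeriv_expNegInvGlue_le :
    ∀ (n : ℕ) (x : ℝ), |iteratedDeriv n expNegInvGlue x| ≤ 9 ^ n * (n.factorial : ℝ) ^ 2 := by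
  intro n x
  rcases le_or_gt x 0 with hx | hx
  · rw [gevrey_iteratedDeriv_eq_zero_of_nonpos n hx, abs_zero]; positivity
  · exact gevrey_abs_iteratedDeriv_le_of_pos n hx

/-- The same bound for the Fréchet derivatives (`‖Dⁿf‖ = |f⁽ⁿ⁾|` in one variable). [folklore] -/
theorem gevrey_norm_iteratedFDeriv_expNegInvGlue_le (n : ℕ) (x : ℝ) :
    ‖iteratedFDeriv ℝ n expNegInvGlue x‖ ≤ 9 ^ n * (n.factorial : ℝ) ^ 2 := by
  rw [norm_iteratedFDeriv_eq_norm_iteratedDeriv, Real.norm_eq_abs]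
  exact gevrey_abs_iteratedDeriv_expNegInvGlue_le n x

/-- **Geometric form up to a fixed order** (the hypothesis shape of Mathlib's `norm_iteratedFDeriv_comp_le`): for
`i ≤ N`, `‖Dⁱ expNegInvGlue(x)‖ ≤ (9 N²)ⁱ` (`i! ≤ iⁱ ≤ Nⁱ`). [folklore] -/
theorem gevrey_norm_iteratedFDeriv_expNegInvGlue_le_geom {N i : ℕ} (hi : i ≤ N) (x : ℝ) :
    ‖iteratedFDeriv ℝ i expNegInvGlue x‖ ≤ (9 * (N : ℝ) ^ 2) ^ i := by
  refine (gevrey_norm_iteratedFDeriv_expNegInvGlue_le i x).trans ?_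
  have h1 : (i.factorial : ℝ) ≤ (N : ℝ) ^ i := by
    have h := (Nat.factorial_le_pow i).trans (Nat.pow_le_pow_left hi i)
    exact_mod_cast h
  have h0 : (0 : ℝ) ≤ i.factorial := Nat.cast_nonneg _
  calc (9 : ℝ) ^ i * (i.factorial : ℝ) ^ 2 ≤ 9 ^ i * ((N : ℝ) ^ i) ^ 2 := by gcongr
    _ = (9 * (N : ℝ) ^ 2) ^ i := by ring

end Summit.QuantumFields.YangMills.Theorems.ContinuumLegGivenGap

end
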